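import Summits.Ventures.LatticeQCDFlow.Scaling.HubChainEigenbasis

/-!
HONEST FRAMING: exact (Metropolis-corrected) sampling algorithms for lattice gauge theory; figures
of merit are autocorrelation/cost numbers at stated couplings and volumes; no continuum-physics
claim.

# HubChainTwoStepDomination — CONJECTURE M′ AT TWO ATTEMPTS, IN FULL: FOR THE LABELLED MIN-KERNEL HUB CHAIN WITH ARBITRARY DEPTHS, RAISING ONE PARTICLE'S DEPTH NEVER RAISES A TWO-STEP
# TRANSITION PROBABILITY BETWEEN TWO OTHER DISTINCT PARTICLES: `P_Y²(i,j) ≤ P_X²(i,j)` FOR ALL `i ≠ j` OFF THE TAG (lean-2 GEN-39, ours)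

Venture-side (OURS).  Cell `lqcd-flow` (pub-lqcd), unit `pub-lqcd-lean-2-g39`, 2026-08-30.  Chapter Y, file 15.  Two depth profiles `ρ^X, ρ^Y > 0` on `ℕ` (NO ordering assumed) agreeing off one index
`s` with `ρ^X_s ≤ ρ^Y_s`; kernels `P(i,j) = c·min{1,ρ_j/ρ_i}` off the diagonal with unit row sums on `range m` (file 1's hypothesis-equations).  Only three terms of
`P²(i,j) = Σ_lP(i,l)P(l,j)` see `ρ_s` — the holding terms `l = i`, `l = j` (which fall) and the passage through the tag `l = s` (which may rise) — and the scalar inequality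
`min{1,v}min{1,r/v} − min{1,u}min{1,r/u} ≤ min{1,r}·[(min{1,v}−min{1,u}) + (min{1,v/r}−min{1,u/r})]` (`0 < u ≤ v`, `r > 0`) says the falls win:

* `twoStep_prod_min` (`min{1,t}·min{1,r/t} = min{min{1,r}, min{t, r/t}}`), **`twoStep_scalar`**;
* `twoStep_offdiag_agree`, `twoStep_diag_diff` (`P_Y(i,i) − P_X(i,i) = −(P_Y(i,s) − P_X(i,s))`), `twoStep_sum_three` (the sum reduces to the three terms);
* **`twoStep_domination`**: `Σ_lP_Y(i,l)P_Y(l,j) ≤ Σ_lP_X(i,l)P_X(l,j)` for `i ≠ j`, `i, j ≠ s`, all below `m`.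

With file 5 (the diagonal rises at `n = 2` in an instance) this settles the two-attempt picture of Conjecture M′ completely: off the diagonal YES for every configuration, on the diagonal
NO.  Literature grade (cell rule): OWN, elementary; nothing cited; no new bib keys.
-/

open Finset

namespace Summit.Ventures.LatticeQCDFlow.Scaling

/-! ### §1 The scalar inequality -/
section Scalar

/-- `min{1,t}·min{1,r/t} = min{min{1,r}, min{t, r/t}}` for `t, r > 0`. [ours] -/
theorem twoStep_prod_min {t r : ℝ} (ht : 0 < t) (hr : 0 < r) : min 1 t * min 1 (r / t) = min (min 1 r) (min t (r / t)) := by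
  have e : t * (r / t) = r := by field_simp
  rcases le_total t 1 with h1 | h1
  · -- `t ≤ 1`, so `r ≤ r/t`
    have hrr : r ≤ r / t := by rw [le_div_iff₀ ht]; nlinarith
    rw [min_eq_right h1]
    rcases le_total (r / t) 1 with h2 | h2
    · -- `r/t ≤ 1`: `r ≤ t`, both sides `= r`
      have hrt : r ≤ t := by have := mul_le_mul_of_nonneg_left h2 ht.le; nlinarith
      rw [min_eq_right h2, e, min_eq_right (hrt.trans h1), min_eq_left (le_min hrt hrr)]
    · -- `r/t ≥ 1`: `t ≤ r`, both sides `= t`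
      have htr : t ≤ r := by have := mul_le_mul_of_nonneg_left h2 ht.le; nlinarith
      rw [min_eq_left h2, mul_one, min_eq_left (h1.trans h2), min_eq_right (le_min h1 htr)]
  · -- `t ≥ 1`, so `r/t ≤ r`
    have hrr : r / t ≤ r := div_le_self hr.le h1
    rw [min_eq_left h1, one_mul]
    rcases le_total (r / t) 1 with h2 | h2
    · rw [min_eq_right h2, min_eq_right (h2.trans h1), min_eq_right (le_min h2 hrr)]
    · have hr1 : 1 ≤ r := h2.trans hrr
      rw [min_eq_left h2, min_eq_left hr1, min_eq_left (le_min h1 h2)]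

/-- **THE SCALAR INEQUALITY:** for `0 < u ≤ v` and `r > 0`,
`min{1,v}min{1,r/v} − min{1,u}min{1,r/u} ≤ min{1,r}·[(min{1,v} − min{1,u}) + (min{1,v/r} − min{1,u/r})]`. [ours] -/
theorem twoStep_scalar {u v r : ℝ} (hu : 0 < u) (huv : u ≤ v) (hr : 0 < r) :
    min 1 v * min 1 (r / v) - min 1 u * min 1 (r / u) ≤ min 1 r * ((min 1 v - min 1 u) + (min 1 (v / r) - min 1 (u / r))) := by
  have hv : 0 < v := lt_of_lt_of_le hu huv
  set μ := min (1:ℝ) r with hμ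
  have hμ0 : 0 < μ := lt_min one_pos hr
  have hΔ1 : 0 ≤ min 1 v - min 1 u := sub_nonneg.mpr (min_le_min le_rfl huv)
  have hΔ2 : 0 ≤ min 1 (v / r) - min 1 (u / r) := sub_nonneg.mpr (min_le_min le_rfl (div_le_div_of_nonneg_right huv hr.le))
  rw [twoStep_prod_min hv hr, twoStep_prod_min hu hr, ← hμ]
  -- step 1: `G(v) − G(u) ≤ min(μ,v) − min(μ,u)` with `G(t) = min(μ, min(t, r/t))`
  have step1 : min μ (min v (r / v)) - min μ (min u (r / u)) ≤ min μ v - min μ u := by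
    have hGv : min μ (min v (r / v)) ≤ min μ v := min_le_min le_rfl (min_le_left _ _)
    rcases le_or_gt (min μ u) (r / u) with h | h
    · -- `G(u) = min(μ,u)`
      have hGu : min μ (min u (r / u)) = min μ u := by rw [← min_assoc]; exact min_eq_left h
      linarith
    · -- `G(u) = r/u ≥ r/v ≥ G(v)`; and `min(μ,v) ≥ min(μ,u)`
      have hGu : min μ (min u (r / u)) = r / u := by
        rw [← min_assoc]; exact min_eq_right h.le
      have hGv' : min μ (min v (r / v)) ≤ r / u :=
        (min_le_right _ _).trans ((min_le_right _ _).trans (div_le_div_of_nonneg_left hr.le hu huv))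
      have hmono : min μ u ≤ min μ v := min_le_min le_rfl huv
      linarith
  -- step 2: `min(μ,v) − min(μ,u) ≤ μ(Δ1 + Δ2)`
  have step2 : min μ v - min μ u ≤ μ * ((min 1 v - min 1 u) + (min 1 (v / r) - min 1 (u / r))) := by
    rcases le_or_gt 1 r with h1 | h1
    · have hμ1 : μ = 1 := by rw [hμ]; exact min_eq_left h1
      rw [hμ1]; linarith
    · have hμr : μ = r := by rw [hμ]; exact min_eq_right h1.le
      rw [hμr]
      have e1 : min r v = r * min 1 (v / r) := by rw [mul_min_of_nonneg _ _ hr.le, mul_one, mul_div_cancel₀ _ hr.ne']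
      have e2 : min r u = r * min 1 (u / r) := by rw [mul_min_of_nonneg _ _ hr.le, mul_one, mul_div_cancel₀ _ hr.ne']
      rw [e1, e2]
      nlinarith
  linarith

end Scalar

/-! ### §2 The two-step comparison -/
section TwoStep
variable {m s : ℕ} {ρX ρY : ℕ → ℝ} {c : ℝ} {PX PY : ℕ → ℕ → ℝ}

/-- Off-diagonal entries not touching the tag agree. [ours] -/
theorem twoStep_offdiag_agree (hagree : ∀ i, i ≠ s → ρX i = ρY i)
    (hPXoff : ∀ i j, i ≠ j → PX i j = c * min 1 (ρX j / ρX i)) (hPYoff : ∀ i j, i ≠ j → PY i j = c * min 1 (ρY j / ρY i))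
    {a b : ℕ} (hab : a ≠ b) (ha : a ≠ s) (hb : b ≠ s) : PY a b = PX a b := by
  rw [hPXoff a b hab, hPYoff a b hab, hagree a ha, hagree b hb]

/-- **The holding probability falls by exactly the rise of the jump to the tag:** `P_Y(i,i) − P_X(i,i) = −(P_Y(i,s) − P_X(i,s))` for `i ≠ s` below `m` (`s < m`). [ours] -/
theorem twoStep_diag_diff (hagree : ∀ i, i ≠ s → ρX i = ρY i)
    (hPXoff : ∀ i j, i ≠ j → PX i j = c * min 1 (ρX j / ρX i)) (hPXdiag : ∀ i, PX i i = 1 - ∑ j ∈ (range m).erase i, PX i j)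
    (hPYoff : ∀ i j, i ≠ j → PY i j = c * min 1 (ρY j / ρY i)) (hPYdiag : ∀ i, PY i i = 1 - ∑ j ∈ (range m).erase i, PY i j)
    {i : ℕ} (his : i ≠ s) (hs : s < m) : PY i i - PX i i = -(PY i s - PX i s) := by
  rw [hPXdiag i, hPYdiag i]
  have hsum : ∑ j ∈ (range m).erase i, PY i j - ∑ j ∈ (range m).erase i, PX i j = PY i s - PX i s := by
    rw [← sum_sub_distrib]
    rw [Finset.sum_eq_single s (fun l hl hls => ?_) (fun h => absurd (mem_erase.mpr ⟨Ne.symm his, mem_range.mpr hs⟩) h)]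
    rw [twoStep_offdiag_agree hagree hPXoff hPYoff (ne_of_mem_erase hl).symm his hls, sub_self]
  linarith

/-- The two-step sums differ only through the three indices `i`, `j`, `s`. [ours] -/
theorem twoStep_sum_three (hagree : ∀ i, i ≠ s → ρX i = ρY i)
    (hPXoff : ∀ i j, i ≠ j → PX i j = c * min 1 (ρX j / ρX i)) (hPYoff : ∀ i j, i ≠ j → PY i j = c * min 1 (ρY j / ρY i))
    {i j : ℕ} (hi : i < m) (hj : j < m) (hs : s < m) (hij : i ≠ j) (his : i ≠ s) (hjs : j ≠ s) :
    (∑ l ∈ range m, PY i l * PY l j) - ∑ l ∈ range m, PX i l * PX l j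
      = (PY i i - PX i i) * PX i j + PX i j * (PY j j - PX j j) + (PY i s * PY s j - PX i s * PX s j) := by
  classical
  have hPij : PY i j = PX i j := twoStep_offdiag_agree hagree hPXoff hPYoff hij his hjs
  rw [← sum_sub_distrib]
  -- peel off `s`, `i`, `j`
  rw [← Finset.add_sum_erase _ _ (mem_range.mpr hs)]
  rw [← Finset.add_sum_erase _ _ (mem_erase.mpr ⟨his, mem_range.mpr hi⟩)]
  rw [← Finset.add_sum_erase _ _ (mem_erase.mpr ⟨hij.symm, mem_erase.mpr ⟨hjs, mem_range.mpr hj⟩⟩)]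
  have hrest : ∑ l ∈ (((range m).erase s).erase i).erase j, (PY i l * PY l j - PX i l * PX l j) = 0 := by
    refine sum_eq_zero fun l hl => ?_
    have hlj : l ≠ j := ne_of_mem_erase hl
    have hl' := mem_of_mem_erase hl
    have hli : l ≠ i := ne_of_mem_erase hl'
    have hls : l ≠ s := ne_of_mem_erase (mem_of_mem_erase hl')
    rw [twoStep_offdiag_agree hagree hPXoff hPYoff hli.symm his hls, twoStep_offdiag_agree hagree hPXoff hPYoff hlj hls hjs, sub_self]
  rw [hrest, hPij]
  ring

/-- **TWO-ATTEMPT DOMINATION OFF THE DIAGONAL, IN FULL:** `Σ_lP_Y(i,l)P_Y(l,j) ≤ Σ_lP_X(i,l)P_X(l,j)` for `i ≠ j`, both `≠ s`, all indices below `m`, depths `> 0` agreeing off `s` with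
`ρ^X_s ≤ ρ^Y_s`, `c ≥ 0` — no ordering of the depths is assumed. [ours] -/
theorem twoStep_domination (hρX : ∀ i, 0 < ρX i) (hρY : ∀ i, 0 < ρY i) (hagree : ∀ i, i ≠ s → ρX i = ρY i) (htag : ρX s ≤ ρY s) (hc : 0 ≤ c)
    (hPXoff : ∀ i j, i ≠ j → PX i j = c * min 1 (ρX j / ρX i)) (hPXdiag : ∀ i, PX i i = 1 - ∑ j ∈ (range m).erase i, PX i j)
    (hPYoff : ∀ i j, i ≠ j → PY i j = c * min 1 (ρY j / ρY i)) (hPYdiag : ∀ i, PY i i = 1 - ∑ j ∈ (range m).erase i, PY i j)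
    {i j : ℕ} (hi : i < m) (hj : j < m) (hs : s < m) (hij : i ≠ j) (his : i ≠ s) (hjs : j ≠ s) :
    ∑ l ∈ range m, PY i l * PY l j ≤ ∑ l ∈ range m, PX i l * PX l j := by
  rw [← sub_nonpos, twoStep_sum_three hagree hPXoff hPYoff hi hj hs hij his hjs,
    twoStep_diag_diff hagree hPXoff hPXdiag hPYoff hPYdiag his hs, twoStep_diag_diff hagree hPXoff hPXdiag hPYoff hPYdiag hjs hs]
  -- the six entries through the tag, in the variables `u = ρ^X_s/ρ_i`, `v = ρ^Y_s/ρ_i`, `r = ρ_j/ρ_i`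
  have hρi := hρX i; have hρj := hρX j; have ha := hρX s; have hb := hρY s
  have hρiY : ρY i = ρX i := (hagree i his).symm
  have hρjY : ρY j = ρX j := (hagree j hjs).symm
  have eXis : PX i s = c * min 1 (ρX s / ρX i) := hPXoff i s his
  have eYis : PY i s = c * min 1 (ρY s / ρX i) := by rw [hPYoff i s his, hρiY]
  have eXjs : PX j s = c * min 1 (ρX s / ρX j) := hPXoff j s hjs
  have eYjs : PY j s = c * min 1 (ρY s / ρX j) := by rw [hPYoff j s hjs, hρjY]
  have eXsj : PX s j = c * min 1 (ρX j / ρX s) := hPXoff s j (Ne.symm hjs)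
  have eYsj : PY s j = c * min 1 (ρX j / ρY s) := by rw [hPYoff s j (Ne.symm hjs), hρjY]
  have eXij : PX i j = c * min 1 (ρX j / ρX i) := hPXoff i j hij
  rw [eXis, eYis, eXjs, eYjs, eXsj, eYsj, eXij]
  -- reduce to the scalar inequality
  have key := twoStep_scalar (u := ρX s / ρX i) (v := ρY s / ρX i) (r := ρX j / ρX i) (div_pos ha hρi) (div_le_div_of_nonneg_right htag hρi.le) (div_pos hρj hρi)
  have e1 : ρX j / ρX i / (ρY s / ρX i) = ρX j / ρY s := by field_simp
  have e2 : ρX j / ρX i / (ρX s / ρX i) = ρX j / ρX s := by field_simp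
  have e3 : ρY s / ρX i / (ρX j / ρX i) = ρY s / ρX j := by field_simp
  have e4 : ρX s / ρX i / (ρX j / ρX i) = ρX s / ρX j := by field_simp
  rw [e1, e2, e3, e4] at key
  have hc2 : 0 ≤ c * c := mul_nonneg hc hc
  nlinarith [mul_le_mul_of_nonneg_left key hc2]

end TwoStep

end Summit.Ventures.LatticeQCDFlow.Scaling
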